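import Summits.ValiantsHypothesis.ValiantsHypothesis.Theses.BarrierLever
import Summits.ValiantsHypothesis.ValiantsHypothesis.Theorems.BarrierLeverLevelCollapse
import Summits.ValiantsHypothesis.ValiantsHypothesis.Theorems.BarrierLeverDcSliceCoversVP
import Summits.ValiantsHypothesis.ValiantsHypothesis.Theorems.BarrierLeverSuccinctHittingSetsForVPADDoor
import Summits.ValiantsHypothesis.ValiantsHypothesis.Theorems.BarrierLeverSingleSizeEquationsReductions
import Literature.Computability.AlgebraicComplexity.DeterminantalComplexityProofs

/-!
# Crux `BarrierLever.DefinableDcEquations` (stmt-ValiantsHypothesis-8746) — status theorems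

Route `BarrierLever`, rank-4 crux `DefinableDcEquations` ("DefDcEq"): for SOME super-quasi-quadratic
threshold `m` (`2^(C (log₂ n + 1)²) ≤ m n` eventually, every `C`) there are `a, n₀` such that for
`n ≥ n₀` a nonzero level-`a` boolean sum `E = boolSum H` (`q`, `L(H)`, `deg H ≤ N^a`,
`N = C(2n,n)`) in the `N` coefficient variables vanishes at `coeff f` for every `f` with
`deg f ≤ n` and determinantal complexity `dc f ≤ m n`.  The tree already has
`DcSliceCoversVP : DefDcEq → DefinableEquations` (stmt-8748, `dcSliceCoversVP_proof`) and
`DefinableEquations ↔ SingleSizeEquations` (stmt-8745 ↔ stmt-8749, lead c7).  This file records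
where DefDcEq sits, in the tree's own vocabulary and with no new definitions:

* §1 **the sandwich**  `DefDcEq → DefinableEquations → PolyDcEq`, where PolyDcEq (written out, not
  named) is "ONE level `a` of boolean-sum equations against `{deg f ≤ n, dc f ≤ n^c}` for EVERY
  `c`" — equations against `VBP`-type slices; the second arrow is `VBP_{n,c} ⊆ VP_{n,7c+11}`
  (`ADDoor.smallDet_subset_smallCircuits`, Berkowitz).  So the rank-4 crux is the rank-3 crux plus
  the passage from polynomial to quasi-polynomial determinantal thresholds, and the rank-3 crux is
  PolyDcEq plus the passage from `VBP` to `VP`.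
* §2 **the VBP lever**: `SuccinctHittingSetsForVBP → PolyDcEq → ValiantsHypothesis` — the route's
  assembly (`SuccinctHittingSetsForVP → DefinableEquations → VH`, `barrierLeverAssembly_proof`) runs
  verbatim one class lower, with the STRONGER hitting hypothesis of item stmt-18966 and the WEAKER
  equation hypothesis PolyDcEq (`levelCollapse_proof` is class-agnostic).
* §3 **what refuting the crux means**: `¬ DefDcEq` iff for EVERY admissible threshold `m` and every
  level `a`, infinitely often in `n`, the slice `{deg ≤ n, dc ≤ m n}` hits every nonzero level-`a`
  boolean sum (a `VNP(N)`-succinct hitting property of quasi-polynomial determinantal expressions).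
* §4 **calibration of the growth clause**: for ANY threshold with `m n < n` the equation clause of
  DefDcEq holds trivially at level `a = 0` (`deg f ≤ dc f < n`, so the coefficient of `x₀ⁿ` is an
  equation) — all content of the crux is in the growth clause forcing `m n ≥ n` (indeed
  `m n ≥ 2^(C log² n)`), where no equation of any constructivity below quasi-polynomial is known
  (Chatterjee–Tengse 2023 §1.3 direction 2, one class below their `VPSPACE` bound, as for rank 3).

Pure bookkeeping over landed theorems; no definitions, no named facts, standard axioms.
-/

-- `Summit.ValiantsHypothesis.ValiantsHypothesis.…` repeats a component by the D-0017 layout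
-- (single-conjunct summit); the `dupNamespace` linter flags the mandated name.
set_option linter.dupNamespace false

noncomputable section

namespace Summit.ValiantsHypothesis.ValiantsHypothesis.Theorems.BarrierLeverDefinableDcEquations

open MvPolynomial
open Literature.Computability.AlgebraicComplexity Literature.Barriers.ValiantsHypothesis
open Summit.ValiantsHypothesis.ValiantsHypothesis.Theses.BarrierLever
open scoped BigOperators

/-! ## §1 The sandwich `DefDcEq → DefinableEquations → PolyDcEq` -/

/-- **`DefinableEquations → PolyDcEq`.**  One level `a` of boolean-sum equations against
`SmallCircuits ℂ n b` for every `b` gives one level `a` of boolean-sum equations against the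
polynomial determinantal slices `{f : deg f ≤ n, dc f ≤ n ^ c}` for every `c`: for `n ≥ 3`,
`{deg ≤ n, dc ≤ n^c} ⊆ SmallCircuits ℂ n (7c + 11)` (`ADDoor.smallDet_subset_smallCircuits`,
Berkowitz `L(det_m) ≤ 8(m+1)^7` plus the affine substitution). [folklore] -/
theorem polyDcEquations_of_definableEquations (h : DefinableEquations) :
    ∃ a : ℕ, ∀ c : ℕ, ∃ n₀ : ℕ, ∀ n ≥ n₀, ∃ q : ℕ, q ≤ (Nat.choose (2 * n) n) ^ a ∧
      ∃ H : MvPolynomial (↥(degLEMonomials n) ⊕ Fin q) ℂ,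
        complexity H ≤ (Nat.choose (2 * n) n) ^ a ∧ H.totalDegree ≤ (Nat.choose (2 * n) n) ^ a ∧
        boolSum H ≠ 0 ∧
        ∀ f : MvPolynomial (Fin n) ℂ, f.totalDegree ≤ n → determinantalComplexity f ≤ n ^ c →
          eval (coeffVector (degLEMonomials n) f) (boolSum H) = 0 := by
  obtain ⟨a, ha⟩ := h
  refine ⟨a, fun c => ?_⟩
  obtain ⟨n₀, hn₀⟩ := ha (7 * c + 11)
  refine ⟨max n₀ 3, fun n hn => ?_⟩
  have hn₀' : n₀ ≤ n := (le_max_left _ _).trans hn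
  have hn3 : 3 ≤ n := (le_max_right _ _).trans hn
  obtain ⟨q, hq, H, hHc, hHd, hne, hvan⟩ := hn₀ n hn₀'
  refine ⟨q, hq, H, hHc, hHd, hne, fun f hdeg hdc => hvan f ?_⟩
  exact _root_.Summit.ValiantsHypothesis.ValiantsHypothesis.Theorems.BarrierLever.SuccinctHittingSetsForVP.ADDoor.smallDet_subset_smallCircuits
    hn3 c ⟨hdeg, hdc⟩

/-- **`DefDcEq → PolyDcEq`** (the two ends of the sandwich): the rank-4 crux gives one level of
boolean-sum equations against every polynomial determinantal slice `{deg ≤ n, dc ≤ n^c}`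
(through `DcSliceCoversVP`, `dcSliceCoversVP_proof`, and `polyDcEquations_of_definableEquations`).
[folklore] -/
theorem polyDcEquations_of_definableDcEquations (h : DefinableDcEquations) :
    ∃ a : ℕ, ∀ c : ℕ, ∃ n₀ : ℕ, ∀ n ≥ n₀, ∃ q : ℕ, q ≤ (Nat.choose (2 * n) n) ^ a ∧
      ∃ H : MvPolynomial (↥(degLEMonomials n) ⊕ Fin q) ℂ,
        complexity H ≤ (Nat.choose (2 * n) n) ^ a ∧ H.totalDegree ≤ (Nat.choose (2 * n) n) ^ a ∧
        boolSum H ≠ 0 ∧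
        ∀ f : MvPolynomial (Fin n) ℂ, f.totalDegree ≤ n → determinantalComplexity f ≤ n ^ c →
          eval (coeffVector (degLEMonomials n) f) (boolSum H) = 0 :=
  polyDcEquations_of_definableEquations
    (Summit.ValiantsHypothesis.ValiantsHypothesis.Theorems.dcSliceCoversVP_proof h)

/-- **`DefDcEq → SingleSizeEquations`**: the rank-4 crux implies the support item
stmt-ValiantsHypothesis-8749 (through `DefinableEquations`, `dcSliceCoversVP_proof` and
`SingleSizeEquations.singleSizeEquations_of_definableEquations`). [folklore] -/
theorem singleSizeEquations_of_definableDcEquations (h : DefinableDcEquations) :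
    SingleSizeEquations :=
  Summit.ValiantsHypothesis.ValiantsHypothesis.Theorems.SingleSizeEquations.singleSizeEquations_of_definableEquations
    (Summit.ValiantsHypothesis.ValiantsHypothesis.Theorems.dcSliceCoversVP_proof h)

/-! ## §2 The lever one class lower: `VBP`-succinct hitting sets and equations against `VBP` -/

/-- **The VBP lever.**  If `VBP`-succinct hitting sets exist (item stmt-ValiantsHypothesis-18966:
for every level `a'` some slice `{deg ≤ n, dc ≤ n^b}` hits `Distinguishers ℂ n a'` eventually) and
ONE level `a` of boolean-sum equations exists against `{deg ≤ n, dc ≤ n^c}` for EVERY `c`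
(PolyDcEq, written out), then `VP_ℂ ≠ VNP_ℂ`.  Same contradiction as the route's assembly: under
`VP = VNP`, `LevelCollapse` (`levelCollapse_proof`) puts the level-`a` equation for `c = b` into
`Distinguishers ℂ n a'`, nonzero and vanishing on the very slice that hits it. [folklore] -/
theorem valiantsHypothesis_of_forVBP_of_polyDcEquations (hSHS : SuccinctHittingSetsForVBP)
    (hEq : ∃ a : ℕ, ∀ c : ℕ, ∃ n₀ : ℕ, ∀ n ≥ n₀, ∃ q : ℕ, q ≤ (Nat.choose (2 * n) n) ^ a ∧
      ∃ H : MvPolynomial (↥(degLEMonomials n) ⊕ Fin q) ℂ,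
        complexity H ≤ (Nat.choose (2 * n) n) ^ a ∧ H.totalDegree ≤ (Nat.choose (2 * n) n) ^ a ∧
        boolSum H ≠ 0 ∧
        ∀ f : MvPolynomial (Fin n) ℂ, f.totalDegree ≤ n → determinantalComplexity f ≤ n ^ c →
          eval (coeffVector (degLEMonomials n) f) (boolSum H) = 0) :
    ValiantsHypothesis := by
  classical
  refine Classical.byContradiction fun hV => ?_
  obtain ⟨a, ha⟩ := hEq
  obtain ⟨a', n₁, hcol⟩ := Summit.ValiantsHypothesis.Theorems.levelCollapse_proof hV a
  obtain ⟨b, n₀, hhit⟩ := hSHS a'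
  obtain ⟨n₀', hdef⟩ := ha b
  obtain ⟨q, hq, H, hHc, hHd, hne, hvan⟩ := hdef (n₀ + n₀' + n₁) (by omega)
  obtain ⟨f, hf, hfne⟩ :=
    hhit (n₀ + n₀' + n₁) (by omega) _ (hcol (n₀ + n₀' + n₁) (by omega) q hq H hHc hHd) hne
  exact hfne (hvan f hf.1 hf.2)

/-- **Corollaries of the VBP lever**: `SuccinctHittingSetsForVBP → DefinableEquations → VH` and
`SuccinctHittingSetsForVBP → DefDcEq → VH` (each equation hypothesis implies PolyDcEq, §1).  The
first is also `ADDoor.succinctHittingSetsForVP_of_forVBP` followed by the assembly; the point of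
§2 is that the equation side may be weakened to PolyDcEq at the same time. [folklore] -/
theorem valiantsHypothesis_of_forVBP_of_definableEquations (hSHS : SuccinctHittingSetsForVBP)
    (h : DefinableEquations) : ValiantsHypothesis :=
  valiantsHypothesis_of_forVBP_of_polyDcEquations hSHS (polyDcEquations_of_definableEquations h)

/-- See `valiantsHypothesis_of_forVBP_of_definableEquations`: the rank-4 crux version.
[folklore] -/
theorem valiantsHypothesis_of_forVBP_of_definableDcEquations (hSHS : SuccinctHittingSetsForVBP)
    (h : DefinableDcEquations) : ValiantsHypothesis :=
  valiantsHypothesis_of_forVBP_of_polyDcEquations hSHS (polyDcEquations_of_definableDcEquations h)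

/-! ## §3 What refuting the crux would prove -/

/-- **The negation of the crux, unfolded.**  `DefDcEq` fails iff for EVERY threshold function `m`
satisfying the growth clause and every level `a`, for infinitely many `n`, every nonzero level-`a`
boolean sum (`q ≤ N^a`, `L(H), deg H ≤ N^a`) is nonzero at `coeff f` for some `f` with `deg f ≤ n`
and `dc f ≤ m n` — the degree-`≤ n` polynomials of quasi-polynomial determinantal complexity would
be a succinct hitting set against `VNP(N)`-type distinguishers infinitely often, for every
admissible `m` at once.  (Pure logic.) [folklore] -/
theorem not_definableDcEquations_iff :
    ¬ DefinableDcEquations ↔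
      ∀ m : ℕ → ℕ, (∀ C : ℕ, ∃ n₀ : ℕ, ∀ n ≥ n₀, 2 ^ (C * (Nat.log 2 n + 1) ^ 2) ≤ m n) →
        ∀ a n₀ : ℕ, ∃ n : ℕ, n₀ ≤ n ∧ ∀ q : ℕ, q ≤ (Nat.choose (2 * n) n) ^ a →
          ∀ H : MvPolynomial (↥(degLEMonomials n) ⊕ Fin q) ℂ,
            complexity H ≤ (Nat.choose (2 * n) n) ^ a → H.totalDegree ≤ (Nat.choose (2 * n) n) ^ a →
            boolSum H ≠ 0 →
            ∃ f : MvPolynomial (Fin n) ℂ, f.totalDegree ≤ n ∧ determinantalComplexity f ≤ m n ∧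
              eval (coeffVector (degLEMonomials n) f) (boolSum H) ≠ 0 := by
  unfold DefinableDcEquations
  constructor
  · intro h m hm a n₀
    push Not at h
    obtain ⟨n, hn, hall⟩ := h m hm a n₀
    exact ⟨n, hn, fun q hq H hc hd h0 => hall q hq H hc hd h0⟩
  · rintro h ⟨m, hm, a, n₀, hdef⟩
    obtain ⟨n, hn, hall⟩ := h m hm a n₀
    obtain ⟨q, hq, H, hHc, hHd, hne, hvan⟩ := hdef n hn
    obtain ⟨f, hfdeg, hfdc, hfne⟩ := hall q hq H hHc hHd hne
    exact hfne (hvan f hfdeg hfdc)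

/-- **One direction kept separately for refuters**: from `¬ DefDcEq`, every admissible threshold
`m` yields, for every level `a`, infinitely many `n` at which `{deg ≤ n, dc ≤ m n}` is a succinct
hitting set for `Distinguishers ℂ n a` (distinguishers are boolean sums with no boolean
variables, `SingleSizeEquations.distinguisher_isBoolSum`). [folklore] -/
theorem isSuccinctHittingSet_io_of_not_definableDcEquations (h : ¬ DefinableDcEquations)
    (m : ℕ → ℕ) (hm : ∀ C : ℕ, ∃ n₀ : ℕ, ∀ n ≥ n₀, 2 ^ (C * (Nat.log 2 n + 1) ^ 2) ≤ m n)
    (a n₀ : ℕ) :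
    ∃ n : ℕ, n₀ ≤ n ∧ IsSuccinctHittingSet (degLEMonomials n)
      {f : MvPolynomial (Fin n) ℂ | f.totalDegree ≤ n ∧ determinantalComplexity f ≤ m n}
      (Distinguishers ℂ n a) := by
  obtain ⟨n, hn, hall⟩ := not_definableDcEquations_iff.mp h m hm a n₀
  refine ⟨n, hn, fun D hD hD0 => ?_⟩
  obtain ⟨hc, hdeg, hsum⟩ :=
    Summit.ValiantsHypothesis.ValiantsHypothesis.Theorems.SingleSizeEquations.distinguisher_isBoolSum hD
  obtain ⟨f, hfdeg, hfdc, hne⟩ := hall 0 (Nat.zero_le _) _ hc hdeg (by rwa [hsum])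
  exact ⟨f, ⟨hfdeg, hfdc⟩, by rwa [hsum] at hne⟩

/-! ## §4 Calibration: below the degree the equation clause is trivial -/

/-- **The growth clause carries all the content.**  For ANY threshold function `m` with `m n < n`
(`n ≥ 1`), the equation clause of `DefDcEq` holds at level `a = 0` from `n₀ = 1` on: `deg f ≤ dc f`
(`totalDegree_le_determinantalComplexity_holds`, Mignon–Ressayre §1) gives `deg f < n` on the slice,
so the single coefficient variable `c_{x₀ⁿ}` (no boolean variables, no gates, degree `1`) is a
nonzero equation.  Hence nothing below the degree can replace the super-quasi-quadratic growth
clause; at `m n ≥ n` no sub-quasi-polynomial equation is known. [folklore] -/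
theorem dcEquations_of_threshold_lt (m : ℕ → ℕ) (hm : ∀ n, 1 ≤ n → m n < n) :
    ∃ a n₀ : ℕ, ∀ n ≥ n₀, ∃ q : ℕ, q ≤ (Nat.choose (2 * n) n) ^ a ∧
      ∃ H : MvPolynomial (↥(degLEMonomials n) ⊕ Fin q) ℂ,
        complexity H ≤ (Nat.choose (2 * n) n) ^ a ∧ H.totalDegree ≤ (Nat.choose (2 * n) n) ^ a ∧
        boolSum H ≠ 0 ∧
        ∀ f : MvPolynomial (Fin n) ℂ, f.totalDegree ≤ n → determinantalComplexity f ≤ m n →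
          eval (coeffVector (degLEMonomials n) f) (boolSum H) = 0 := by
  classical
  refine ⟨0, 1, fun n hn => ?_⟩
  -- the exponent vector of `x₀ⁿ`, of degree `n`
  have hn0 : 0 < n := hn
  let e : Fin n →₀ ℕ := Finsupp.single ⟨0, hn0⟩ n
  have he : e.degree = n := by
    simp [e, Finsupp.degree_single]
  let μ : ↥(degLEMonomials n) := ⟨e, by show e.degree ≤ n; rw [he]⟩
  refine ⟨0, Nat.zero_le _, MvPolynomial.rename Sum.inl (X μ), ?_, ?_, ?_, ?_⟩
  · -- no gates
    rw [MvPolynomial.rename_X, complexity_X_holds]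
    exact Nat.zero_le _
  · -- degree one
    rw [MvPolynomial.rename_X, pow_zero, totalDegree_X]
  · -- nonzero
    rw [Summit.ValiantsHypothesis.ValiantsHypothesis.Theorems.SingleSizeEquations.boolSum_rename_inl]
    exact X_ne_zero μ
  · -- vanishing: `deg f ≤ dc f ≤ m n < n = deg x₀ⁿ`
    intro f hdeg hdc
    rw [Summit.ValiantsHypothesis.ValiantsHypothesis.Theorems.SingleSizeEquations.boolSum_rename_inl,
      eval_X, coeffVector_apply]
    have hlt : f.totalDegree < n :=
      lt_of_le_of_lt ((totalDegree_le_determinantalComplexity_holds f).trans hdc) (hm n hn)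
    apply coeff_eq_zero_of_totalDegree_lt
    change f.totalDegree < ∑ i ∈ e.support, e i
    rw [← Finsupp.degree_apply, he]
    exact hlt

end Summit.ValiantsHypothesis.ValiantsHypothesis.Theorems.BarrierLeverDefinableDcEquations

end
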